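import Summits.CriticalPhenomena.PercolationContinuityZ3.Theorems.PercNearOneGluingNoHeavyLowerTailQ44ComplementaryPackingAbstract
import HarnessLib
import HarnessLib.Audit.Tags
import Summits.CriticalPhenomena.PercolationContinuityZ3.Theorems.PercNearOneGluingNoHeavyLowerTailQ44WeightedCount

/-!
# Sockets for the darts-only packing `D_U` (the `C8` lemma) and for Conjecture W, from abstract typed-configuration counts

Two parts, both resting on `…Q44ComplementaryPackingAbstract` (`PackU`); seat `prim-bnk-1` gen 35, memo
`run/shared/lean/prim/prim-l12/FROM-prim-bnk-1-gen35-U-PACKING-HALL.md` §2b, §3b.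

## Part A — the darts-only packing `D_U`
# The darts-only packing `D_U` and its abstract count (the `C8` lemma socket)

Support file for crux `stmt-CriticalPhenomena-4575` (master-family programme; packing `U` / Conjecture W line), seat `prim-bnk-1` gen 35; memo
`run/shared/lean/prim/prim-l12/FROM-prim-bnk-1-gen35-U-PACKING-HALL.md` §3b.

Cells as in `FourPointAtoms.pat4`.  The eight DARTS `(p,t)` (crossing pair ; three-block containing exactly one end of `p`) of the packing `U`
are `(2,10) (2,13) (3,10) (3,12) (4,7) (4,13) (5,7) (5,12)`; they are the edges of an 8-cycle `by–acy–bc–aby–ac–bcy–ay–abc–by` (memo §3).  The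
darts-only packing
  `D_U := c₀c₁₄ − ½·Σ_darts c_p c_t ≥ 0`
is implied by `U ≥ 0`, has NO certificate of degree ≤ 3 over the law-level dictionary and an exact pseudo-law (kit j221050), while `c₀c₁₄ ≥ ⅜·Σ`
is certified (kit j223298): the step `⅜ → ½` is new.  Its fibre form is the **C8 lemma** of the memo (complements of the crossing sides: eight families on a
cycle, near families cross-intersecting, `#(near differences ∪ far intersections) ≥ ½·Σ sizes`; exhaustive on `|E| ≤ 4`: 699 199 208 configurations).
This file is its socket:
* `TwoCopyMono.kerDU`, `sum_kerDU_cell` — the kernel of `4·D_U`;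
* `TwoCopyMono.goodKernel_kerDU_iff_count` — `GoodKernel kerDU ↔` (dart points ≤ 2 · good points) along every monotone cell map;
* `TwoCopyMono.packDU_of_goodKernel` — the law-level reduction;
* **`PackU.AbstractDartCount`** (OPEN; = `PackU.AbstractCount` restricted to dart-typed families = the C8 lemma) and
  `PackU.abstractDartCount_of_abstractCount`, **`PackU.goodKernel_kerDU_of_abstractDartCount`**, `PackU.packDU_of_abstractDartCount`.
No sorries, no named facts, standard axioms.

## Part B — Conjecture W from `COUNT*_W`
# Conjecture W (`2·Q44 ≥ 0` for all `n`) from an ABSTRACT typed-configuration count with PAIR-FORCED goods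

Support file for crux `stmt-CriticalPhenomena-4575` (master-family programme; Conjecture W = row `Q44` ∀`n` of `prim-bnk-1` gen 20, the
fibre socket `TwoCopyMono.goodKernel_kerQ44_iff_weightedCount` / `q44_cells_of_goodKernel` of `…Q44WeightedCount`), seat `prim-bnk-1`
gen 35; memo `run/shared/lean/prim/prim-l12/FROM-prim-bnk-1-gen35-U-PACKING-HALL.md` §2b.

Observation of the memo (exhaustive on all 70 807 209 monotone maps of `B₄` and on all 27 688 950 pairwise order-consistent abstract
`W`-typed configurations on `≤ 5` points): the weighted count `#B1-points + #dart-points ≤ 2·#AC-goods` behind Conjecture W already holds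
with the goods FORCED BY PAIRS of bad points — the corners `T ∪ T'`, `T ∪ T'ᶜ`, `Tᶜ ∪ T'`, `Tᶜ ∪ T'ᶜ` whose value is forced into
`AC = {ab|cy, abcy}` (join table `PackW.joinAC`) with complement forced to `a|b|c|y` (meet table `PackU.meetBot`) — and the capacity-2
two-sided Hall system on them is satisfiable.  Hence Conjecture W follows from the purely set-theoretic statement

* **`PackW.AbstractCount`** (`COUNT*_W`, OPEN): for every finite type, every value map `v : Finset γ → Fin 15` and every family `𝒯` of sets
  whose types `(v T, v Tᶜ)` are `W`-types (`PackW.wTypes`: the five weight-two pairs in one orientation and the eight darts (pair; block)),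
  order-consistent on its sides, `2·#{weight-two members} + #{dart members} ≤ 2·#PackW.forcedGoods v 𝒯`;
* `PackW.forcedGoods_good` — along a monotone cell map every forced good `G` has `ι G ∈ AC`, `ι Gᶜ = a|b|c|y`;
* **`PackW.goodKernel_kerQ44_of_abstractCount`**, **`PackW.q44_cells_of_abstractCount`** — `COUNT*_W ⟹ GoodKernel kerQ44 ⟹ 2·Q44 ≥ 0`
  on every finite weighted graph, all `n` (the cell form of `TwoCopyMono.q44_cells_of_goodKernel`).
Pure finite combinatorics + table facts by `decide`; no sorries, no named facts, standard axioms.  The hypothesis is the open statement.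
-/

namespace Summit.CriticalPhenomena.PercolationContinuityZ3.Theorems

namespace TwoCopyMono

open Finset FourPointAtoms

/-- **The integer kernel of `4·D_U`**: `2·[uTop] − [uD]`. [this work] -/
def kerDU (i j : Fin 15) : ℤ := 2 * indK uTop i j - indK uD i j

/-- Evaluation: `Σ κᵢⱼ cᵢ cⱼ = 4c₀c₁₄ − 2·Σ_darts c_p c_t = 4·D_U(c)`. [this work] -/
theorem sum_kerDU_cell (c : Fin 15 → ℝ) :
    (∑ i : Fin 15, ∑ j : Fin 15, (kerDU i j : ℝ) * c i * c j) =
      4 * (c 0 * c 14) - 2 * (c 2 * (c 10 + c 13) + c 3 * (c 10 + c 12) + c 4 * (c 7 + c 13) + c 5 * (c 7 + c 12)) := by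
  have hU := sum_kerU_cell c
  have hsplit : ∀ i j : Fin 15, (kerDU i j : ℝ) * c i * c j =
      (kerU i j : ℝ) * c i * c j + 2 * ((indK uB i j : ℝ) * c i * c j) := by
    intro i j; unfold kerDU kerU; push_cast; ring
  simp_rw [hsplit, Finset.sum_add_distrib, ← Finset.mul_sum]
  rw [hU, sum_indK_cell]
  have hB : (∑ p ∈ uB, c p.1 * c p.2) = 2 * (c 11 * (c 2 + c 3 + c 4 + c 5 + c 8 + c 9)) := by
    unfold uB
    rw [Finset.sum_insert (by decide), Finset.sum_insert (by decide), Finset.sum_insert (by decide), Finset.sum_insert (by decide),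
      Finset.sum_insert (by decide), Finset.sum_insert (by decide), Finset.sum_insert (by decide), Finset.sum_insert (by decide),
      Finset.sum_insert (by decide), Finset.sum_insert (by decide), Finset.sum_insert (by decide), Finset.sum_singleton]
    ring
  rw [hB]; ring

/-- The antipodal sum of `kerDU` along a cell map, in point counts. [this work] -/
theorem sum_kerDU_map {γ : Type*} [Fintype γ] [DecidableEq γ] (ι : Finset γ → Fin 15) :
    (∑ T : Finset γ, kerDU (ι T) (ι Tᶜ)) =
      2 * (#(Finset.univ.filter fun T => (ι T, ι Tᶜ) ∈ uTop) : ℤ) - (#(Finset.univ.filter fun T => (ι T, ι Tᶜ) ∈ uD) : ℤ) := by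
  unfold kerDU
  rw [Finset.sum_sub_distrib, ← Finset.mul_sum, sum_indK_map, sum_indK_map]

/-- **`GoodKernel kerDU` is the count** `#{dart points} ≤ 2·#{good points}` along every monotone cell map. [this work] -/
theorem goodKernel_kerDU_iff_count :
    GoodKernel kerDU ↔
      ∀ (γ : Type) [Fintype γ] [DecidableEq γ] (ι : Finset γ → Fin 15),
        (∀ A B : Finset γ, A ⊆ B → ple (ι A) (ι B) = true) →
          #(Finset.univ.filter fun T => (ι T, ι Tᶜ) ∈ uD) ≤ 2 * #(Finset.univ.filter fun T => (ι T, ι Tᶜ) ∈ uTop) := by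
  classical
  have hsum : ∀ (γ : Type) [Fintype γ] [DecidableEq γ] (ι : Finset γ → Fin 15),
      (∑ T : Finset γ, liftK kerDU (pp (ι T)) (pp (ι Tᶜ))) =
        2 * (#(Finset.univ.filter fun T => (ι T, ι Tᶜ) ∈ uTop) : ℤ) - (#(Finset.univ.filter fun T => (ι T, ι Tᶜ) ∈ uD) : ℤ) := by
    intro γ _ _ ι
    have h1 : ∀ T : Finset γ, liftK kerDU (pp (ι T)) (pp (ι Tᶜ)) = kerDU (ι T) (ι Tᶜ) := fun T => liftK_pp _ _ _
    simp_rw [h1]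
    exact sum_kerDU_map ι
  constructor
  · intro hK γ _ _ ι hmono
    have hmono' : ∀ A B : Finset γ, A ⊆ B → ProfLE (pp (ι A)) (pp (ι B)) :=
      fun A B hAB => profLE_of_ple (hmono A B hAB)
    have h0 : 0 ≤ ∑ T : Finset γ, liftK kerDU (pp (ι T)) (pp (ι Tᶜ)) :=
      hK.nonneg γ (fun T => pp (ι T)) hmono' (fun T => isEqv_pp (ι T))
    rw [hsum γ ι] at h0
    have : (#(Finset.univ.filter fun T => (ι T, ι Tᶜ) ∈ uD) : ℤ) ≤
        2 * (#(Finset.univ.filter fun T => (ι T, ι Tᶜ) ∈ uTop) : ℤ) := by linarith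
    exact_mod_cast this
  · intro hcount
    refine ⟨fun γ _ _ P hmono heqv => ?_⟩
    have hex : ∀ T : Finset γ, ∃ i : Fin 15, P T = pp i := fun T => exists_pat_of_isEqv (heqv T)
    choose ι hι using hex
    have hle : ∀ A B : Finset γ, A ⊆ B → ple (ι A) (ι B) = true := by
      intro A B hAB
      apply ple_of_profLE
      rw [← hι A, ← hι B]
      exact hmono A B hAB
    have hc := hcount γ ι hle
    have hP : (∑ T : Finset γ, liftK kerDU (P T) (P Tᶜ)) = ∑ T : Finset γ, liftK kerDU (pp (ι T)) (pp (ι Tᶜ)) := by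
      refine Finset.sum_congr rfl fun T _ => ?_
      rw [hι T, hι Tᶜ]
    rw [hP, hsum γ ι]
    have : (#(Finset.univ.filter fun T => (ι T, ι Tᶜ) ∈ uD) : ℤ) ≤
        2 * (#(Finset.univ.filter fun T => (ι T, ι Tᶜ) ∈ uTop) : ℤ) := by exact_mod_cast hc
    linarith

variable {n : ℕ}

/-- **`D_U ≥ 0` for all `n` from its kernel**: `Σ_darts c_p c_t ≤ 2·c₀c₁₄` on every finite weighted graph. [this work] -/
theorem packDU_of_goodKernel (hK : GoodKernel kerDU) (w : Sym2 (Fin n) → unitInterval) (a b c y : Fin n) :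
    cell w a b c y 2 * (cell w a b c y 10 + cell w a b c y 13) + cell w a b c y 3 * (cell w a b c y 10 + cell w a b c y 12) +
        cell w a b c y 4 * (cell w a b c y 7 + cell w a b c y 13) + cell w a b c y 5 * (cell w a b c y 7 + cell w a b c y 12) ≤
      2 * (cell w a b c y 0 * cell w a b c y 14) := by
  have h := sum_kernel_cell_nonneg hK w a b c y
  rw [sum_kerDU_cell] at h
  linarith

end TwoCopyMono

namespace PackU

open Finset FourPointAtoms TwoCopyMono

variable {γ : Type*} [Fintype γ] [DecidableEq γ]

/-- **The darts-only abstract count (= the C8 lemma of the memo; OPEN).**  For every finite type, value map `v` and family `𝒴` of dart-typed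
sets, order-consistent on its sides: `#𝒴 ≤ 2·#forcedGoods v 𝒴`.  Exhaustively verified for `|γ| ≤ 4` (699 199 208 configurations with the
covering constraint only) and `|γ| = 5` under full consistency. [this work] -/
@[conjecture] def AbstractDartCount : Prop :=
  ∀ (γ : Type) [Fintype γ] [DecidableEq γ] (v : Finset γ → Fin 15) (𝒴 : Finset (Finset γ)),
    (∀ Y ∈ 𝒴, (v Yᶜ, v Y) ∈ uDY) →
      (∀ S ∈ sides 𝒴, ∀ S' ∈ sides 𝒴, S ⊆ S' → ple (v S) (v S') = true) →
        #𝒴 ≤ 2 * #(forcedGoods v 𝒴)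

/-- The full abstract count implies the darts-only one. [this work] -/
theorem abstractDartCount_of_abstractCount (h : AbstractCount) : AbstractDartCount := by
  intro γ _ _ v 𝒴 htyp hcons
  have htyp' : ∀ Y ∈ 𝒴, (v Yᶜ, v Y) ∈ uTypesY := by
    intro Y hY; rw [uTypesY_eq, Finset.mem_union]; exact Or.inr (htyp Y hY)
  have h1 := h γ v 𝒴 htyp' hcons
  have hD : (𝒴.filter fun Y => (v Yᶜ, v Y) ∈ uDY) = 𝒴 := by
    ext Y; rw [Finset.mem_filter]; exact ⟨fun h => h.1, fun hY => ⟨hY, htyp Y hY⟩⟩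
  rw [hD] at h1
  omega

/-- **The C8 lemma implies `GoodKernel kerDU`.** [this work] -/
theorem goodKernel_kerDU_of_abstractDartCount (h : AbstractDartCount) : GoodKernel kerDU := by
  classical
  rw [goodKernel_kerDU_iff_count]
  intro γ _ _ ι hmono
  set 𝒴 : Finset (Finset γ) := Finset.univ.filter fun Y => (ι Yᶜ, ι Y) ∈ uDY with h𝒴
  have htyp : ∀ Y ∈ 𝒴, (ι Yᶜ, ι Y) ∈ uDY := fun Y hY => (Finset.mem_filter.1 hY).2
  have hcons : ∀ S ∈ sides 𝒴, ∀ S' ∈ sides 𝒴, S ⊆ S' → ple (ι S) (ι S') = true := fun S _ S' _ hSS' => hmono S S' hSS'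
  have hcount := h γ ι 𝒴 htyp hcons
  have hD : #𝒴 = #(Finset.univ.filter fun T : Finset γ => (ι Tᶜ, ι T) ∈ uDY) := by rw [h𝒴]
  have hDswap : #(Finset.univ.filter fun T : Finset γ => (ι Tᶜ, ι T) ∈ uDY) =
      #(Finset.univ.filter fun T : Finset γ => (ι T, ι Tᶜ) ∈ uDY) :=
    card_filter_compl_swap ι (fun i j => (i, j) ∈ uDY)
  have hTswap : #(Finset.univ.filter fun T : Finset γ => ι Tᶜ = 14 ∧ ι T = 0) =
      #(Finset.univ.filter fun T : Finset γ => ι T = 14 ∧ ι Tᶜ = 0) :=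
    card_filter_compl_swap ι (fun i j => i = 14 ∧ j = 0)
  have hDpts : #(Finset.univ.filter fun T : Finset γ => (ι T, ι Tᶜ) ∈ uD) =
      #(Finset.univ.filter fun T : Finset γ => (ι T, ι Tᶜ) ∈ uDY) + #(Finset.univ.filter fun T : Finset γ => (ι Tᶜ, ι T) ∈ uDY) := by
    have := card_filter_or_disjoint ι (fun i j => (i, j) ∈ uDY) (fun i j => (j, i) ∈ uDY) uDY_asymm
    rw [← this]; congr 1; ext T; simp only [Finset.mem_filter, Finset.mem_univ, true_and]; exact mem_uD_iff _ _
  have hTpts : #(Finset.univ.filter fun T : Finset γ => (ι T, ι Tᶜ) ∈ uTop) =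
      #(Finset.univ.filter fun T : Finset γ => ι T = 14 ∧ ι Tᶜ = 0) + #(Finset.univ.filter fun T : Finset γ => ι Tᶜ = 14 ∧ ι T = 0) := by
    have := card_filter_or_disjoint ι (fun i j => i = 14 ∧ j = 0) (fun i j => j = 14 ∧ i = 0) top_asymm
    rw [← this]; congr 1; ext T; simp only [Finset.mem_filter, Finset.mem_univ, true_and]; exact mem_uTop_iff _ _
  have hG := card_forcedGoods_le ι hmono 𝒴
  rw [hDpts, hTpts, ← hDswap, ← hD, hTswap]
  omega

variable {n : ℕ}

/-- **`D_U ≥ 0` on every finite weighted graph from the C8 lemma.** [this work] -/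
theorem packDU_of_abstractDartCount (h : AbstractDartCount) (w : Sym2 (Fin n) → unitInterval) (a b c y : Fin n) :
    cell w a b c y 2 * (cell w a b c y 10 + cell w a b c y 13) + cell w a b c y 3 * (cell w a b c y 10 + cell w a b c y 12) +
        cell w a b c y 4 * (cell w a b c y 7 + cell w a b c y 13) + cell w a b c y 5 * (cell w a b c y 7 + cell w a b c y 12) ≤
      2 * (cell w a b c y 0 * cell w a b c y 14) :=
  packDU_of_goodKernel (goodKernel_kerDU_of_abstractDartCount h) w a b c y

end PackU

end Summit.CriticalPhenomena.PercolationContinuityZ3.Theorems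

namespace Summit.CriticalPhenomena.PercolationContinuityZ3.Theorems

namespace PackW

open Finset FourPointAtoms TwoCopyMono PackU

/-! ## Types and tables -/

/-- The 13 oriented `W`-types `(v T, v Tᶜ)`: the five weight-two pairs of `2·Q44` in ONE orientation and the eight darts (pair; block).
[this work] -/
def wTypes : Finset (Fin 15 × Fin 15) :=
  {(11, 9), (11, 8), (6, 8), (6, 1), (1, 8), (2, 13), (1, 13), (5, 12), (1, 12), (6, 10), (6, 7), (2, 10), (5, 7)}

/-- The weight-two types among them. [this work] -/
def wB1 : Finset (Fin 15 × Fin 15) := {(11, 9), (11, 8), (6, 8), (6, 1), (1, 8)}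

/-- Join table into `AC`: every cell above both `i` and `j` is `ab|cy` or `abcy`. [this work] -/
def joinAC (i j : Fin 15) : Bool := decide (∀ k : Fin 15, ple i k = true → ple j k = true → isAC k)

/-- The `W`-types are the weight-two types and the darts of `…Q44WeightedCount`. [this work] -/
theorem wTypes_eq : wTypes = wB1 ∪ q44Darts := by decide

/-- `q44B1` is `wB1` in both orientations (table). [this work] -/
theorem mem_q44B1_iff (i j : Fin 15) : (i, j) ∈ q44B1 ↔ (i, j) ∈ wB1 ∨ (j, i) ∈ wB1 := by
  revert i j; decide

/-- No weight-two type is the reverse of one (table). [this work] -/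
theorem wB1_asymm (i j : Fin 15) : (i, j) ∈ wB1 → (j, i) ∉ wB1 := by
  revert i j; decide

/-! ## Forced goods and the abstract count -/

variable {γ : Type*} [Fintype γ] [DecidableEq γ]

/-- The four pair-forced corners of two members `T, T'` (values forced into `AC`, complement values forced to bottom). [this work] -/
def corners (v : Finset γ → Fin 15) (T T' : Finset γ) : Finset (Finset γ) :=
  (if joinAC (v T) (v T') = true ∧ meetBot (v Tᶜ) (v T'ᶜ) = true then {T ∪ T'} else ∅) ∪
    ((if joinAC (v T) (v T'ᶜ) = true ∧ meetBot (v Tᶜ) (v T') = true then {T ∪ T'ᶜ} else ∅) ∪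
      ((if joinAC (v Tᶜ) (v T') = true ∧ meetBot (v T) (v T'ᶜ) = true then {Tᶜ ∪ T'} else ∅) ∪
        (if joinAC (v Tᶜ) (v T'ᶜ) = true ∧ meetBot (v T) (v T') = true then {Tᶜ ∪ T'ᶜ} else ∅)))

/-- **Forced goods** of a `W`-configuration: all pair-forced corners. [this work] -/
def forcedGoods (v : Finset γ → Fin 15) (𝒯 : Finset (Finset γ)) : Finset (Finset γ) :=
  (𝒯 ×ˢ 𝒯).biUnion fun p => corners v p.1 p.2

/-- **`COUNT*_W` (abstract typed-configuration count for Conjecture W; OPEN, memo gen 35 §2b).** [this work] -/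
@[conjecture] def AbstractCount : Prop :=
  ∀ (γ : Type) [Fintype γ] [DecidableEq γ] (v : Finset γ → Fin 15) (𝒯 : Finset (Finset γ)),
    (∀ T ∈ 𝒯, (v T, v Tᶜ) ∈ wTypes) →
      (∀ S ∈ PackU.sides 𝒯, ∀ S' ∈ PackU.sides 𝒯, S ⊆ S' → ple (v S) (v S') = true) →
        2 * #(𝒯.filter fun T => (v T, v Tᶜ) ∈ wB1) + #(𝒯.filter fun T => (v T, v Tᶜ) ∈ q44Darts) ≤ 2 * #(forcedGoods v 𝒯)

/-! ## Forced goods are `AC`-goods along a monotone cell map -/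

/-- Reading the join table. [this work] -/
theorem isAC_of_joinAC {i j k : Fin 15} (h : joinAC i j = true) (hi : ple i k = true) (hj : ple j k = true) : isAC k := by
  unfold joinAC at h; rw [decide_eq_true_iff] at h; exact h k hi hj

/-- A corner with `AC` join and bottom complement-meet is an `AC`-good. [this work] -/
theorem good_of_tables (ι : Finset γ → Fin 15) (hmono : ∀ A B : Finset γ, A ⊆ B → ple (ι A) (ι B) = true)
    (P Q : Finset γ) (hj : joinAC (ι P) (ι Q) = true) (hm : meetBot (ι Pᶜ) (ι Qᶜ) = true) :
    isAC (ι (P ∪ Q)) ∧ ι (P ∪ Q)ᶜ = 0 := by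
  refine ⟨isAC_of_joinAC hj (hmono _ _ subset_union_left) (hmono _ _ subset_union_right), ?_⟩
  refine eq_bot_of_meetBot hm (hmono _ _ ?_) (hmono _ _ ?_)
  · rw [Finset.compl_union]; exact Finset.inter_subset_left
  · rw [Finset.compl_union]; exact Finset.inter_subset_right

/-- Members of `corners` are `AC`-goods along a monotone cell map. [this work] -/
theorem corners_good (ι : Finset γ → Fin 15) (hmono : ∀ A B : Finset γ, A ⊆ B → ple (ι A) (ι B) = true)
    (T T' G : Finset γ) (hG : G ∈ corners ι T T') : isAC (ι G) ∧ ι Gᶜ = 0 := by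
  unfold corners at hG
  rcases Finset.mem_union.1 hG with h1 | h234
  · split_ifs at h1 with hc
    · rw [Finset.mem_singleton] at h1; subst h1; exact good_of_tables ι hmono T T' hc.1 hc.2
    · exact absurd h1 (Finset.notMem_empty _)
  · rcases Finset.mem_union.1 h234 with h2 | h34
    · split_ifs at h2 with hc
      · rw [Finset.mem_singleton] at h2; subst h2
        have hm : meetBot (ι Tᶜ) (ι T'ᶜᶜ) = true := by rw [compl_compl]; exact hc.2
        exact good_of_tables ι hmono T T'ᶜ hc.1 hm
      · exact absurd h2 (Finset.notMem_empty _)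
    · rcases Finset.mem_union.1 h34 with h3 | h4
      · split_ifs at h3 with hc
        · rw [Finset.mem_singleton] at h3; subst h3
          have hm : meetBot (ι Tᶜᶜ) (ι T'ᶜ) = true := by rw [compl_compl]; exact hc.2
          exact good_of_tables ι hmono Tᶜ T' hc.1 hm
        · exact absurd h3 (Finset.notMem_empty _)
      · split_ifs at h4 with hc
        · rw [Finset.mem_singleton] at h4; subst h4
          have hm : meetBot (ι Tᶜᶜ) (ι T'ᶜᶜ) = true := by rw [compl_compl, compl_compl]; exact hc.2
          exact good_of_tables ι hmono Tᶜ T'ᶜ hc.1 hm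
        · exact absurd h4 (Finset.notMem_empty _)

/-- **Forced goods are `AC`-goods.** [this work] -/
theorem forcedGoods_good (ι : Finset γ → Fin 15) (hmono : ∀ A B : Finset γ, A ⊆ B → ple (ι A) (ι B) = true)
    (𝒯 : Finset (Finset γ)) (G : Finset γ) (hG : G ∈ forcedGoods ι 𝒯) : isAC (ι G) ∧ ι Gᶜ = 0 := by
  unfold forcedGoods at hG
  rw [Finset.mem_biUnion] at hG
  obtain ⟨p, _, hp⟩ := hG
  exact corners_good ι hmono p.1 p.2 G hp

/-- Hence there are at most as many forced goods as `AC`-goods. [this work] -/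
theorem card_forcedGoods_le (ι : Finset γ → Fin 15) (hmono : ∀ A B : Finset γ, A ⊆ B → ple (ι A) (ι B) = true)
    (𝒯 : Finset (Finset γ)) :
    #(forcedGoods ι 𝒯) ≤ #(Finset.univ.filter fun T => isAC (ι T) ∧ ι Tᶜ = 0) := by
  refine Finset.card_le_card fun G hG => ?_
  rw [Finset.mem_filter]
  exact ⟨Finset.mem_univ _, forcedGoods_good ι hmono 𝒯 G hG⟩

/-! ## The reduction -/

/-- **`COUNT*_W` implies the weighted count**, hence `GoodKernel kerQ44`. [this work] -/
theorem goodKernel_kerQ44_of_abstractCount (h : AbstractCount) : GoodKernel kerQ44 := by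
  classical
  rw [goodKernel_kerQ44_iff_weightedCount]
  intro γ _ _ ι hmono
  set 𝒯 : Finset (Finset γ) := Finset.univ.filter fun T => (ι T, ι Tᶜ) ∈ wTypes with h𝒯
  have htyp : ∀ T ∈ 𝒯, (ι T, ι Tᶜ) ∈ wTypes := fun T hT => (Finset.mem_filter.1 hT).2
  have hcons : ∀ S ∈ PackU.sides 𝒯, ∀ S' ∈ PackU.sides 𝒯, S ⊆ S' → ple (ι S) (ι S') = true :=
    fun S _ S' _ hSS' => hmono S S' hSS'
  have hcount := h γ ι 𝒯 htyp hcons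
  have hB : #(𝒯.filter fun T => (ι T, ι Tᶜ) ∈ wB1) = #(Finset.univ.filter fun T : Finset γ => (ι T, ι Tᶜ) ∈ wB1) := by
    congr 1; ext T
    simp only [h𝒯, Finset.mem_filter, Finset.mem_univ, true_and, wTypes_eq, Finset.mem_union]
    constructor
    · rintro ⟨_, h2⟩; exact h2
    · intro h2; exact ⟨Or.inl h2, h2⟩
  have hD : #(𝒯.filter fun T => (ι T, ι Tᶜ) ∈ q44Darts) = #(Finset.univ.filter fun T : Finset γ => (ι T, ι Tᶜ) ∈ q44Darts) := by
    congr 1; ext T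
    simp only [h𝒯, Finset.mem_filter, Finset.mem_univ, true_and, wTypes_eq, Finset.mem_union]
    constructor
    · rintro ⟨_, h2⟩; exact h2
    · intro h2; exact ⟨Or.inr h2, h2⟩
  have hBswap : #(Finset.univ.filter fun T : Finset γ => (ι Tᶜ, ι T) ∈ wB1) =
      #(Finset.univ.filter fun T : Finset γ => (ι T, ι Tᶜ) ∈ wB1) :=
    card_filter_compl_swap ι (fun i j => (i, j) ∈ wB1)
  have hBpts : #(Finset.univ.filter fun T : Finset γ => (ι T, ι Tᶜ) ∈ q44B1) =
      #(Finset.univ.filter fun T : Finset γ => (ι T, ι Tᶜ) ∈ wB1) + #(Finset.univ.filter fun T : Finset γ => (ι Tᶜ, ι T) ∈ wB1) := by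
    have := card_filter_or_disjoint ι (fun i j => (i, j) ∈ wB1) (fun i j => (j, i) ∈ wB1) wB1_asymm
    rw [← this]; congr 1; ext T; simp only [Finset.mem_filter, Finset.mem_univ, true_and]; exact mem_q44B1_iff _ _
  have hG := card_forcedGoods_le ι hmono 𝒯
  rw [hBpts, hBswap, ← hB, ← hD]
  omega

variable {n : ℕ}

/-- **Conjecture W from `COUNT*_W`**: `2·B1 + D ≤ 2[P(ab|cy)+P(abcy)]·P(a|b|c|y)` on every finite weighted graph (the cell form of
`2·Q44 ≥ 0`, `TwoCopyMono.q44_cells_of_goodKernel`). [this work] -/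
theorem q44_cells_of_abstractCount (h : AbstractCount) (w : Sym2 (Fin n) → unitInterval) (a b c y : Fin n) :
    2 * (cell w a b c y 11 * cell w a b c y 9 + cell w a b c y 11 * cell w a b c y 8 + cell w a b c y 6 * cell w a b c y 8 +
        cell w a b c y 6 * cell w a b c y 1 + cell w a b c y 1 * cell w a b c y 8) +
      (cell w a b c y 2 * cell w a b c y 13 + cell w a b c y 1 * cell w a b c y 13 + cell w a b c y 5 * cell w a b c y 12 +
        cell w a b c y 1 * cell w a b c y 12 + cell w a b c y 6 * cell w a b c y 10 + cell w a b c y 6 * cell w a b c y 7 +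
        cell w a b c y 2 * cell w a b c y 10 + cell w a b c y 5 * cell w a b c y 7) ≤
      2 * ((cell w a b c y 11 + cell w a b c y 14) * cell w a b c y 0) :=
  q44_cells_of_goodKernel (goodKernel_kerQ44_of_abstractCount h) w a b c y

end PackW

end Summit.CriticalPhenomena.PercolationContinuityZ3.Theorems
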